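import Literature.MathematicalPhysics.QuantumFieldTheory.Balaban1983to89.T4Assembly

/-!
# W-AM′ EXIT — the weighted-average matching route typed END-TO-END against the tree sockets
(cell `pub-balaban`, row NE7 ∕ node U5, ideation seat `b2b-balaban-t4-ne7-p2` gen 33; kernel bookkeeping; filed by courier, see COURIER NOTE)

What this file does.  It takes the DISPLAYED per-step data of the W-AM′ route (record `t4/T4-EST-NE7-P2.md` §30–§33:
two positive history expansions of the consecutive dressed partition functions over a synchronised index set — run B's
surplus finest-scale histories set aside in a one-sided drop stage —, t-UNIFORM per-history log-ratio budgets
`ε_τ ≤ e₀(K) + Σ_{X ∈ isl τ} δ_X` around ONE t-INDEPENDENT bulk constant `c_K`, and island-density majorants in the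
absolute GD currency) and concludes LITERALLY the tree's node-U5 shape
`T4CauchySum.MatchingModConstants vol l₀ δ Z` in its `∀ K ∃ c ∀ |t| ≤ l₀` order together with `Summable δ`, then plugs
into the tree's apex consumer `T4Assembly.genFunCauchy_of_matchingModConstants` (per string `os`,
`Z = T4GenFunBounds.schemeZ S os`) — WITHOUT any new `HybridNE7`-level glue member.  This is the structural half of the
lineage question Q-U5-1 (whether such a producer is ADMITTED beside `T4MatchingAssembly.matchingModConstants_schemeZ` is
the carver's call, row T4-U5.L).

Layers.  §1 two-sided Gibbs∕Jensen bound for `log Σb − log Σa` and the averaged matching lemma (gen 29∕30, re-proved);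
§2 Campbell transfer of island budgets to island densities; §3 the drop stage `|log Σ_{T'} B − log Σ_T B| ≤ d` for a
relative surplus `≤ d`; §4 `WAMData l₀ Z` = the displayed data as ONE structure and the exit theorems
`WAMData.abs_log_sub_le`, `WAMData.matchingModConstants`, `WAMData.exit`; §5 the GD discharge of the density
majorants (`pinnedFraction_le`: (G2) global lower bound, (G3′) absolute upper bounds by t-independent history factors,
(G5) comparable normalisations, pinned entropy sums) = constructor `WAMData.ofGD`; §6 the summability arithmetic
(`summable_err_of_ageProfile`: age convolution against a geometric two-run rate; the fine profile
`L^{4a}·e^{−p″⌊a∕N′⌋}` is summable iff `4·log L < p″∕N′` — NE7b's own survival margin); §7 the plug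
`genFunCauchy_of_wamData : (∀ os, ∃ D : WAMData l₀ (schemeZ S os), Summable D.err) → GenFunCauchy S l₀`.

HONEST FRAMING.  continuum YM on T⁴ ⇐ BetaPertH ∧ nine spine estimates (0/9 proved); BetaPertH ⇐ (D1) ∧ (D4) ∧
CAP+tail; G-an2-4 gates asym, D1 and NE2/3/4.  Finite T⁴, rung (B)+1; NOT infinite volume, NOT mass gap, NOT Clay.
Every hypothesis below is an abstract real-analysis shape; NOTHING of Bałaban's is asserted; NE7 is NOT PRINTED and NOT
PROVED — this file is bookkeeping of the implication «displayed W-AM′ data ⇒ node U5 ⇒ node U6 input», no more.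

COURIER NOTE (2026-08-20, prover-b2b-balaban-t4-ne7-p3-g18-0, BINDER-OWNERS row NE7 co-owner #3): filed VERBATIM on behalf of the planner seat `b2b-balaban-t4-ne7-p2` (road W-AM′, skeleton `t4/skeletons/NE7-t4-ne7-p2.md`, its §1/§3 filing request (m1)–(m5)); content = the lineage's kernel scratch named below with ONLY the namespace moved from `T4NE7IdeasG3x` to `Summit.QuantumFields.BalabanUV.T4Continuum.WAM[.…]` and this note added; no statement changed.  Authorship and every claim in the docstrings are that seat's.  THIS FILE (m1 `WAMExit`) = §1–§4 + §8 (toy) of `t4/b2b-balaban-t4-ne7-p2/g36/WAMPrimeExitToy.lean` dcd74fa6ef3f47a8; §5–§7 are the sibling `Support/WAMDensity.lean` (m2) and §8 (the kernel toy) is `Support/WAMExitToy.lean`.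
-/

namespace Summit.QuantumFields.BalabanUV.T4Continuum.WAM

open Finset
open Literature.MathematicalPhysics.QuantumFieldTheory.Balaban1983to89

/-! ## §1 Two-sided Gibbs bound and averaged matching mod constants -/

section Gibbs

variable {ι : Type*} (s : Finset ι) (a b : ι → ℝ)

/-- Upper Gibbs bound (Jensen for the concave `log` under the `b`-weights). -/
theorem log_sum_sub_log_sum_le (hs : s.Nonempty) (ha : ∀ i ∈ s, 0 < a i) (hb : ∀ i ∈ s, 0 < b i) :
    Real.log (∑ i ∈ s, b i) - Real.log (∑ i ∈ s, a i)
      ≤ ∑ i ∈ s, (b i / ∑ j ∈ s, b j) * (Real.log (b i) - Real.log (a i)) := by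
  have hSA : 0 < ∑ j ∈ s, a j := Finset.sum_pos ha hs
  have hSB : 0 < ∑ j ∈ s, b j := Finset.sum_pos hb hs
  have hJ := (strictConcaveOn_log_Ioi.concaveOn).le_map_sum
      (t := s) (w := fun i => b i / ∑ j ∈ s, b j) (p := fun i => a i / b i)
      (fun i hi => div_nonneg (hb i hi).le hSB.le)
      (by rw [← Finset.sum_div]; exact div_self hSB.ne')
      (fun i hi => Set.mem_Ioi.2 (div_pos (ha i hi) (hb i hi)))
  have hpt : ∑ i ∈ s, (b i / ∑ j ∈ s, b j) • (a i / b i) = (∑ j ∈ s, a j) / ∑ j ∈ s, b j := by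
    have : ∀ i ∈ s, (b i / ∑ j ∈ s, b j) • (a i / b i) = a i / ∑ j ∈ s, b j := fun i hi => by
      rw [smul_eq_mul, div_mul_div_comm, mul_comm (b i) (a i), mul_div_mul_right _ _ (hb i hi).ne']
    rw [Finset.sum_congr rfl this, Finset.sum_div]
  rw [hpt, Real.log_div hSA.ne' hSB.ne'] at hJ
  have hlhs : ∑ i ∈ s, (b i / ∑ j ∈ s, b j) • Real.log (a i / b i)
      = -(∑ i ∈ s, (b i / ∑ j ∈ s, b j) * (Real.log (b i) - Real.log (a i))) := by
    rw [← Finset.sum_neg_distrib]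
    refine Finset.sum_congr rfl fun i hi => ?_
    rw [smul_eq_mul, Real.log_div (ha i hi).ne' (hb i hi).ne']; ring
  rw [hlhs] at hJ
  linarith

/-- Lower Gibbs bound (roles of `a`, `b` exchanged). -/
theorem le_log_sum_sub_log_sum (hs : s.Nonempty) (ha : ∀ i ∈ s, 0 < a i) (hb : ∀ i ∈ s, 0 < b i) :
    ∑ i ∈ s, (a i / ∑ j ∈ s, a j) * (Real.log (b i) - Real.log (a i))
      ≤ Real.log (∑ i ∈ s, b i) - Real.log (∑ i ∈ s, a i) := by
  have h := log_sum_sub_log_sum_le s b a hs hb ha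
  have : ∑ i ∈ s, (a i / ∑ j ∈ s, a j) * (Real.log (b i) - Real.log (a i))
      = -(∑ i ∈ s, (a i / ∑ j ∈ s, a j) * (Real.log (a i) - Real.log (b i))) := by
    rw [← Finset.sum_neg_distrib]
    exact Finset.sum_congr rfl fun i _ => by ring
  linarith

/-- AVERAGED matching mod constants: per-term budgets `|log b i − log a i − c| ≤ ε i` (possibly huge on rare terms)
give `|log Σ b − log Σ a − c| ≤ max (Σ (a∕Σa) ε) (Σ (b∕Σb) ε)`. -/
theorem abs_log_sum_sub_le_avg (hs : s.Nonempty) (ha : ∀ i ∈ s, 0 < a i) (hb : ∀ i ∈ s, 0 < b i) (c : ℝ)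
    (ε : ι → ℝ) (hε : ∀ i ∈ s, |Real.log (b i) - Real.log (a i) - c| ≤ ε i) :
    |Real.log (∑ i ∈ s, b i) - Real.log (∑ i ∈ s, a i) - c|
      ≤ max (∑ i ∈ s, (a i / ∑ j ∈ s, a j) * ε i) (∑ i ∈ s, (b i / ∑ j ∈ s, b j) * ε i) := by
  have hSA : 0 < ∑ j ∈ s, a j := Finset.sum_pos ha hs
  have hSB : 0 < ∑ j ∈ s, b j := Finset.sum_pos hb hs
  have hpa : ∑ i ∈ s, a i / ∑ j ∈ s, a j = 1 := by rw [← Finset.sum_div]; exact div_self hSA.ne'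
  have hpb : ∑ i ∈ s, b i / ∑ j ∈ s, b j = 1 := by rw [← Finset.sum_div]; exact div_self hSB.ne'
  have hup := log_sum_sub_log_sum_le s a b hs ha hb
  have hlo := le_log_sum_sub_log_sum s a b hs ha hb
  have eup : ∑ i ∈ s, (b i / ∑ j ∈ s, b j) * (Real.log (b i) - Real.log (a i))
      = c + ∑ i ∈ s, (b i / ∑ j ∈ s, b j) * (Real.log (b i) - Real.log (a i) - c) := by
    have : ∑ i ∈ s, (b i / ∑ j ∈ s, b j) * (Real.log (b i) - Real.log (a i))
        = ∑ i ∈ s, ((b i / ∑ j ∈ s, b j) * (Real.log (b i) - Real.log (a i) - c) + (b i / ∑ j ∈ s, b j) * c) :=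
      Finset.sum_congr rfl fun i _ => by ring
    rw [this, Finset.sum_add_distrib, ← Finset.sum_mul, hpb]; ring
  have elo : ∑ i ∈ s, (a i / ∑ j ∈ s, a j) * (Real.log (b i) - Real.log (a i))
      = c + ∑ i ∈ s, (a i / ∑ j ∈ s, a j) * (Real.log (b i) - Real.log (a i) - c) := by
    have : ∑ i ∈ s, (a i / ∑ j ∈ s, a j) * (Real.log (b i) - Real.log (a i))
        = ∑ i ∈ s, ((a i / ∑ j ∈ s, a j) * (Real.log (b i) - Real.log (a i) - c) + (a i / ∑ j ∈ s, a j) * c) :=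
      Finset.sum_congr rfl fun i _ => by ring
    rw [this, Finset.sum_add_distrib, ← Finset.sum_mul, hpa]; ring
  have bup : ∑ i ∈ s, (b i / ∑ j ∈ s, b j) * (Real.log (b i) - Real.log (a i) - c)
      ≤ ∑ i ∈ s, (b i / ∑ j ∈ s, b j) * ε i :=
    Finset.sum_le_sum fun i hi =>
      mul_le_mul_of_nonneg_left ((le_abs_self _).trans (hε i hi)) (div_nonneg (hb i hi).le hSB.le)
  have blo : -(∑ i ∈ s, (a i / ∑ j ∈ s, a j) * ε i)
      ≤ ∑ i ∈ s, (a i / ∑ j ∈ s, a j) * (Real.log (b i) - Real.log (a i) - c) := by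
    rw [← Finset.sum_neg_distrib]
    refine Finset.sum_le_sum fun i hi => ?_
    have hw : 0 ≤ a i / ∑ j ∈ s, a j := div_nonneg (ha i hi).le hSA.le
    have hx : -ε i ≤ Real.log (b i) - Real.log (a i) - c := by
      linarith [neg_abs_le (Real.log (b i) - Real.log (a i) - c), hε i hi]
    have := mul_le_mul_of_nonneg_left hx hw
    linarith
  have m1 := le_max_left (∑ i ∈ s, (a i / ∑ j ∈ s, a j) * ε i) (∑ i ∈ s, (b i / ∑ j ∈ s, b j) * ε i)
  have m2 := le_max_right (∑ i ∈ s, (a i / ∑ j ∈ s, a j) * ε i) (∑ i ∈ s, (b i / ∑ j ∈ s, b j) * ε i)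
  rw [abs_le]
  constructor <;> linarith

end Gibbs

/-! ## §2 Campbell transfer: per-term island budgets → island densities -/

section Campbell

variable {T P : Type*} [DecidableEq P]

/-- `Σ_τ p τ ε τ ≤ e₀ + Σ_X δ X · p(X ∈ isl τ)` for a probability weight `p` and budgets `ε τ ≤ e₀ + Σ_{X ∈ isl τ} δ X`. -/
theorem avg_le_of_islandBudget (ts : Finset T) (ps : Finset P) (p : T → ℝ) (hp : ∀ τ ∈ ts, 0 ≤ p τ)
    (hp1 : ∑ τ ∈ ts, p τ = 1) (isl : T → Finset P) (hisl : ∀ τ ∈ ts, isl τ ⊆ ps) (e₀ : ℝ) (δ : P → ℝ)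
    (ε : T → ℝ) (hε : ∀ τ ∈ ts, ε τ ≤ e₀ + ∑ X ∈ isl τ, δ X) :
    ∑ τ ∈ ts, p τ * ε τ ≤ e₀ + ∑ X ∈ ps, δ X * ∑ τ ∈ ts.filter (fun τ => X ∈ isl τ), p τ := by
  calc ∑ τ ∈ ts, p τ * ε τ
      ≤ ∑ τ ∈ ts, p τ * (e₀ + ∑ X ∈ isl τ, δ X) :=
        Finset.sum_le_sum fun τ hτ => mul_le_mul_of_nonneg_left (hε τ hτ) (hp τ hτ)
    _ = e₀ + ∑ τ ∈ ts, p τ * ∑ X ∈ isl τ, δ X := by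
        have : ∀ τ ∈ ts, p τ * (e₀ + ∑ X ∈ isl τ, δ X) = p τ * e₀ + p τ * ∑ X ∈ isl τ, δ X := fun τ _ => by ring
        rw [Finset.sum_congr rfl this, Finset.sum_add_distrib, ← Finset.sum_mul, hp1, one_mul]
    _ = e₀ + ∑ τ ∈ ts, ∑ X ∈ ps, (if X ∈ isl τ then p τ * δ X else 0) := by
        congr 1
        refine Finset.sum_congr rfl fun τ hτ => ?_
        have hft : ps.filter (fun X => X ∈ isl τ) = isl τ := by
          ext X
          simp only [Finset.mem_filter]
          exact ⟨fun h => h.2, fun h => ⟨hisl τ hτ h, h⟩⟩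
        conv_lhs => rw [Finset.mul_sum, ← hft, Finset.sum_filter]
    _ = e₀ + ∑ X ∈ ps, ∑ τ ∈ ts, (if X ∈ isl τ then p τ * δ X else 0) := by rw [Finset.sum_comm]
    _ = e₀ + ∑ X ∈ ps, δ X * ∑ τ ∈ ts.filter (fun τ => X ∈ isl τ), p τ := by
        congr 1
        refine Finset.sum_congr rfl fun X _ => ?_
        rw [Finset.sum_filter, Finset.mul_sum]
        refine Finset.sum_congr rfl fun τ _ => ?_
        split_ifs <;> ring

/-- … and under island-density MAJORANTS `p(X ∈ isl τ) ≤ W X` (`δ ≥ 0`): `Σ_τ p τ ε τ ≤ e₀ + Σ_X δ X · W X`. -/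
theorem avg_le_of_densityMajorant (ts : Finset T) (ps : Finset P) (p : T → ℝ) (hp : ∀ τ ∈ ts, 0 ≤ p τ)
    (hp1 : ∑ τ ∈ ts, p τ = 1) (isl : T → Finset P) (hisl : ∀ τ ∈ ts, isl τ ⊆ ps) (e₀ : ℝ) (δ : P → ℝ)
    (ε : T → ℝ) (hδ : ∀ X ∈ ps, 0 ≤ δ X) (hε : ∀ τ ∈ ts, ε τ ≤ e₀ + ∑ X ∈ isl τ, δ X) (W : P → ℝ)
    (hW : ∀ X ∈ ps, ∑ τ ∈ ts.filter (fun τ => X ∈ isl τ), p τ ≤ W X) :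
    ∑ τ ∈ ts, p τ * ε τ ≤ e₀ + ∑ X ∈ ps, δ X * W X :=
  (avg_le_of_islandBudget ts ps p hp hp1 isl hisl e₀ δ ε hε).trans
    (add_le_add le_rfl (Finset.sum_le_sum fun X hX => mul_le_mul_of_nonneg_left (hW X hX) (hδ X hX)))

/-- **WAM.**  Synchronised positive expansions, common t-independent constant `c`, bulk budget `e₀`, island budgets
`δ X ≥ 0`, density majorants `W X` under BOTH runs' normalised weights ⇒ `|log ΣB − log ΣA − c| ≤ e₀ + Σ_X δ X · W X`. -/
theorem wam_matching (ts : Finset T) (hts : ts.Nonempty) (ps : Finset P) (A B : T → ℝ) (hA : ∀ τ ∈ ts, 0 < A τ)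
    (hB : ∀ τ ∈ ts, 0 < B τ) (isl : T → Finset P) (hisl : ∀ τ ∈ ts, isl τ ⊆ ps) (c e₀ : ℝ) (δ : P → ℝ)
    (hδ : ∀ X ∈ ps, 0 ≤ δ X) (hterm : ∀ τ ∈ ts, |Real.log (B τ) - Real.log (A τ) - c| ≤ e₀ + ∑ X ∈ isl τ, δ X)
    (W : P → ℝ) (hWA : ∀ X ∈ ps, ∑ τ ∈ ts.filter (fun τ => X ∈ isl τ), A τ / ∑ σ ∈ ts, A σ ≤ W X)
    (hWB : ∀ X ∈ ps, ∑ τ ∈ ts.filter (fun τ => X ∈ isl τ), B τ / ∑ σ ∈ ts, B σ ≤ W X) :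
    |Real.log (∑ τ ∈ ts, B τ) - Real.log (∑ τ ∈ ts, A τ) - c| ≤ e₀ + ∑ X ∈ ps, δ X * W X := by
  have hSA : 0 < ∑ σ ∈ ts, A σ := Finset.sum_pos hA hts
  have hSB : 0 < ∑ σ ∈ ts, B σ := Finset.sum_pos hB hts
  refine (abs_log_sum_sub_le_avg ts A B hts hA hB c (fun τ => e₀ + ∑ X ∈ isl τ, δ X) hterm).trans (max_le ?_ ?_)
  · refine avg_le_of_densityMajorant ts ps (fun τ => A τ / ∑ σ ∈ ts, A σ)
      (fun τ hτ => div_nonneg (hA τ hτ).le hSA.le) (by rw [← Finset.sum_div]; exact div_self hSA.ne')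
      isl hisl e₀ δ _ hδ (fun τ _ => le_rfl) W fun X hX => ?_
    simpa [Finset.sum_div] using hWA X hX
  · refine avg_le_of_densityMajorant ts ps (fun τ => B τ / ∑ σ ∈ ts, B σ)
      (fun τ hτ => div_nonneg (hB τ hτ).le hSB.le) (by rw [← Finset.sum_div]; exact div_self hSB.ne')
      isl hisl e₀ δ _ hδ (fun τ _ => le_rfl) W fun X hX => ?_
    simpa [Finset.sum_div] using hWB X hX

end Campbell

/-! ## §3 The one-sided drop stage (run B's surplus finest-scale histories, node U5d) -/

section Drop

variable {T : Type*} [DecidableEq T]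

/-- If `T ⊆ T'`, the terms are positive on `T'`, `T` is nonempty and the surplus mass is at most `d` times the retained
mass, then `|log Σ_{T'} B − log Σ_T B| ≤ d` (`0 ≤ log (1 + x) ≤ x`).  No comparison of two runs enters. -/
theorem abs_log_sum_sup_sub_le (ts ts' : Finset T) (hsub : ts ⊆ ts') (hts : ts.Nonempty) (B : T → ℝ)
    (hB : ∀ τ ∈ ts', 0 < B τ) {d : ℝ} (hdrop : ∑ τ ∈ ts' \ ts, B τ ≤ d * ∑ τ ∈ ts, B τ) :
    |Real.log (∑ τ ∈ ts', B τ) - Real.log (∑ τ ∈ ts, B τ)| ≤ d := by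
  have hS : 0 < ∑ τ ∈ ts, B τ := Finset.sum_pos (fun τ hτ => hB τ (hsub hτ)) hts
  have hsplit : ∑ τ ∈ ts', B τ = ∑ τ ∈ ts, B τ + ∑ τ ∈ ts' \ ts, B τ := by
    rw [← Finset.sum_sdiff hsub, add_comm]
  have hsur : 0 ≤ ∑ τ ∈ ts' \ ts, B τ := Finset.sum_nonneg fun τ hτ => (hB τ (Finset.mem_sdiff.1 hτ).1).le
  have hS' : 0 < ∑ τ ∈ ts', B τ := by rw [hsplit]; linarith
  rw [← Real.log_div hS'.ne' hS.ne']
  have hq1 : 1 ≤ (∑ τ ∈ ts', B τ) / ∑ τ ∈ ts, B τ := by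
    rw [le_div_iff₀ hS, one_mul, hsplit]; linarith
  have hq2 : (∑ τ ∈ ts', B τ) / ∑ τ ∈ ts, B τ ≤ 1 + d := by
    rw [div_le_iff₀ hS, hsplit]; nlinarith
  have hlog0 : 0 ≤ Real.log ((∑ τ ∈ ts', B τ) / ∑ τ ∈ ts, B τ) := Real.log_nonneg hq1
  rw [abs_of_nonneg hlog0]
  have hd : 0 ≤ d := by
    by_contra h
    push Not at h
    have : d * ∑ τ ∈ ts, B τ < 0 := mul_neg_of_neg_of_pos h hS
    linarith
  calc Real.log ((∑ τ ∈ ts', B τ) / ∑ τ ∈ ts, B τ) ≤ (∑ τ ∈ ts', B τ) / ∑ τ ∈ ts, B τ - 1 :=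
        Real.log_le_sub_one_of_pos (by linarith)
    _ ≤ d := by linarith

end Drop

/-! ## §4 The displayed data as ONE structure, and the exit to `T4CauchySum.MatchingModConstants` -/

universe u

/-- **THE DISPLAYED W-AM′ DATA for a sequence of dressed partition functions `Z : ℕ → ℝ → ℝ` on the source window
`|t| ≤ l₀`.**  Per step `K`: a synchronised finite history index `ts K` (run A's histories; run B's are `tsB K ⊇ ts K`,
the surplus being B's histories with a large-field island born at B's extra finest scale), POSITIVE history terms
`A K t τ`, `B K t τ` with `Z K t = Σ_{ts K} A`, `Z (K+1) t = Σ_{tsB K} B` (positivity = gauge-invariant conditioning,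
(G1)); islands `isl K τ ⊆ ps K`; ONE t-INDEPENDENT bulk constant `c K`; a t-uniform bulk budget `e₀ K`; t-uniform
per-island log-ratio budgets `δX K X ≥ 0` (possibly LARGE); t-uniform island-density majorants `W K X` valid under both
runs' normalised weights; a t-uniform relative drop budget `d K`.  Nothing here is Bałaban's: it is the SHAPE the
row's estimates would have to instantiate. -/
structure WAMData (l₀ : ℝ) (Z : ℕ → ℝ → ℝ) : Type (u + 1) where
  /-- history index type (all steps) -/
  T : Type u
  /-- island (polymer) label type (all steps) -/
  P : Type u
  [decT : DecidableEq T]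
  [decP : DecidableEq P]
  /-- run A's histories at step `K` (the synchronised support) -/
  ts : ℕ → Finset T
  /-- run B's histories at step `K` -/
  tsB : ℕ → Finset T
  ts_sub : ∀ K, ts K ⊆ tsB K
  ts_ne : ∀ K, (ts K).Nonempty
  A : ℕ → ℝ → T → ℝ
  B : ℕ → ℝ → T → ℝ
  zA : ∀ K t, |t| ≤ l₀ → Z K t = ∑ τ ∈ ts K, A K t τ
  zB : ∀ K t, |t| ≤ l₀ → Z (K + 1) t = ∑ τ ∈ tsB K, B K t τ
  posA : ∀ K t, |t| ≤ l₀ → ∀ τ ∈ ts K, 0 < A K t τ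
  posB : ∀ K t, |t| ≤ l₀ → ∀ τ ∈ tsB K, 0 < B K t τ
  ps : ℕ → Finset P
  isl : ℕ → T → Finset P
  isl_sub : ∀ K, ∀ τ ∈ ts K, isl K τ ⊆ ps K
  /-- the t-INDEPENDENT bulk constant of step `K` -/
  c : ℕ → ℝ
  e₀ : ℕ → ℝ
  δX : ℕ → P → ℝ
  δX_nonneg : ∀ K, ∀ X ∈ ps K, 0 ≤ δX K X
  /-- t-UNIFORM per-history budgets -/
  term : ∀ K t, |t| ≤ l₀ → ∀ τ ∈ ts K,
    |Real.log (B K t τ) - Real.log (A K t τ) - c K| ≤ e₀ K + ∑ X ∈ isl K τ, δX K X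
  W : ℕ → P → ℝ
  densA : ∀ K t, |t| ≤ l₀ → ∀ X ∈ ps K,
    ∑ τ ∈ (ts K).filter (fun τ => X ∈ isl K τ), A K t τ / ∑ σ ∈ ts K, A K t σ ≤ W K X
  densB : ∀ K t, |t| ≤ l₀ → ∀ X ∈ ps K,
    ∑ τ ∈ (ts K).filter (fun τ => X ∈ isl K τ), B K t τ / ∑ σ ∈ ts K, B K t σ ≤ W K X
  d : ℕ → ℝ
  drop : ∀ K t, |t| ≤ l₀ → ∑ τ ∈ tsB K \ ts K, B K t τ ≤ d K * ∑ τ ∈ ts K, B K t τ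

attribute [instance] WAMData.decT WAMData.decP

namespace WAMData

variable {l₀ : ℝ} {Z : ℕ → ℝ → ℝ} (D : WAMData.{u} l₀ Z)

/-- The step-`K` error of the route: drop budget + bulk budget + island budgets paid at their density majorants. -/
def err (K : ℕ) : ℝ := D.d K + (D.e₀ K + ∑ X ∈ D.ps K, D.δX K X * D.W K X)

/-- **THE t-UNIFORM BOUND AROUND THE t-INDEPENDENT CONSTANT.** -/
theorem abs_log_sub_le (K : ℕ) (t : ℝ) (ht : |t| ≤ l₀) :
    |Real.log (Z (K + 1) t) - Real.log (Z K t) - D.c K| ≤ D.err K := by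
  have h1 : |Real.log (∑ τ ∈ D.tsB K, D.B K t τ) - Real.log (∑ τ ∈ D.ts K, D.B K t τ)| ≤ D.d K :=
    abs_log_sum_sup_sub_le (D.ts K) (D.tsB K) (D.ts_sub K) (D.ts_ne K) (D.B K t) (D.posB K t ht) (D.drop K t ht)
  have h2 : |Real.log (∑ τ ∈ D.ts K, D.B K t τ) - Real.log (∑ τ ∈ D.ts K, D.A K t τ) - D.c K|
      ≤ D.e₀ K + ∑ X ∈ D.ps K, D.δX K X * D.W K X :=
    wam_matching (D.ts K) (D.ts_ne K) (D.ps K) (D.A K t) (D.B K t) (D.posA K t ht)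
      (fun τ hτ => D.posB K t ht τ (D.ts_sub K hτ)) (D.isl K) (D.isl_sub K) (D.c K) (D.e₀ K) (D.δX K)
      (D.δX_nonneg K) (D.term K t ht) (D.W K) (D.densA K t ht) (D.densB K t ht)
  rw [D.zA K t ht, D.zB K t ht]
  have h3 := abs_sub_le (Real.log (∑ τ ∈ D.tsB K, D.B K t τ)) (Real.log (∑ τ ∈ D.ts K, D.B K t τ))
    (Real.log (∑ τ ∈ D.ts K, D.A K t τ) + D.c K)
  have e1 : Real.log (∑ τ ∈ D.tsB K, D.B K t τ) - Real.log (∑ τ ∈ D.ts K, D.A K t τ) - D.c K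
      = Real.log (∑ τ ∈ D.tsB K, D.B K t τ) - (Real.log (∑ τ ∈ D.ts K, D.A K t τ) + D.c K) := by ring
  have e2 : Real.log (∑ τ ∈ D.ts K, D.B K t τ) - (Real.log (∑ τ ∈ D.ts K, D.A K t τ) + D.c K)
      = Real.log (∑ τ ∈ D.ts K, D.B K t τ) - Real.log (∑ τ ∈ D.ts K, D.A K t τ) - D.c K := by ring
  rw [e2] at h3
  rw [e1]
  unfold err
  linarith

/-- **EXIT, literal tree shape** (any `vol > 0`; `δ K = err K ∕ vol`). -/
theorem matchingModConstants {vol : ℝ} (hvol : 0 < vol) :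
    T4CauchySum.MatchingModConstants vol l₀ (fun K => D.err K / vol) Z := fun K =>
  ⟨D.c K, fun t ht => by
    have h := D.abs_log_sub_le K t ht
    rwa [mul_div_cancel₀ _ hvol.ne']⟩

/-- **EXIT with `vol = 1`** (on a FIXED torus the volume factor is cosmetic: the apex consumer quantifies `∃ vol`). -/
theorem matchingModConstants_one : T4CauchySum.MatchingModConstants 1 l₀ D.err Z := fun K =>
  ⟨D.c K, fun t ht => by simpa using D.abs_log_sub_le K t ht⟩

/-- **EXIT in the apex consumer's binder shape** `∃ vol δ, Summable δ ∧ MatchingModConstants vol l₀ δ Z`. -/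
theorem exit (hsum : Summable D.err) :
    ∃ (vol : ℝ) (δ : ℕ → ℝ), Summable δ ∧ T4CauchySum.MatchingModConstants vol l₀ δ Z :=
  ⟨1, D.err, hsum, D.matchingModConstants_one⟩

/-- … hence Cauchy generating functions on the window (tree `T4CauchySum.cauchySeq_genFun`). -/
theorem cauchySeq_genFun (hl₀ : 0 ≤ l₀) (hsum : Summable D.err) {t : ℝ} (ht : |t| ≤ l₀) :
    CauchySeq fun K => T4CauchySum.genFun Z K t :=
  T4CauchySum.cauchySeq_genFun D.matchingModConstants_one hl₀ hsum ht

end WAMData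

end Summit.QuantumFields.BalabanUV.T4Continuum.WAM
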